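import Mathlib
import Summits.ValiantsHypothesis.ValiantsHypothesis.Theorems.RigidityForcesSymmetryRankRigidMinimalReprLaplaceFiveOnShellCanon

/-!
# ValiantsHypothesis / RigidityForcesSymmetry — crux `LaplaceOptimalFive` (stmt-ValiantsHypothesis-24813), line
`shallow_collision`, stub S1 `stub_onShell_five`: FLATTENING-LEVEL canonical equations.

Refinement of `…OnShellCanon`: the two fibers `{t | S t = S₀}` and `{t | S t = S₀ᶜ}` of a flattening are merged
into one unknown `Y ω (S₀, Q)` (`S₀` the small side, `Q` the collapsed letter indices read on `S₀`, the other side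
reading `insert 0 ({0,2,3,4} \\ Q)`), and the exactness equation at a collision word `ω ∘ ρ` becomes
`(L.map (Y ω)).sum = 0` over an 8-entry list with `decide`-checkable side conditions (`flat_equation`).

Honest framing.  Bookkeeping only; nothing here proves S1, `LaplaceOptimalFive` (OPEN) or `VP ≠ VNP`.
No definitions, no `sorry`; Mathlib only.
-/

set_option linter.dupNamespace false

namespace Summit.ValiantsHypothesis.ValiantsHypothesis.Theorems.RigidityForcesSymmetryRankRigidMinimalRepr

namespace LaplaceFiveOnShell

open Finset

variable {N : ℕ} (T : Finset (Fin N)) (S : Fin N → Finset (Fin 5)) (u w : Fin N → (Fin 5 → Fin 5) → ℂ)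

/-- **Flattening-level canonical equation** at the collision word `ω ∘ ρ`. [folklore] -/
theorem flat_equation (ho1 : ∀ t v, ((S t).image v).card < (S t).card → u t v = 0)
    (ho3 : ∀ t v, (((S t)ᶜ).image v).card < ((S t)ᶜ).card → w t v = 0)
    (hid : ∀ v : Fin 5 → Fin 5, (∑ t ∈ T, u t v * w t v) = if Function.Injective v then 1 else 0)
    (F G : Fin N → Finset (Fin 5) → ℂ) (hF : ∀ t v, u t v = F t ((S t).image v))
    (hG : ∀ t v, w t v = G t (((S t)ᶜ).image v))
    (Y : (Fin 5 → Fin 5) → Finset (Fin 5) × Finset (Fin 5) → ℂ)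
    (hY : ∀ (ω' : Fin 5 → Fin 5) (S₀ Q : Finset (Fin 5)), Y ω' (S₀, Q)
      = (∑ t ∈ T.filter (fun t => S t = S₀),
          F t (Q.image ω') * G t ((insert (0 : Fin 5) (({0, 2, 3, 4} : Finset (Fin 5)) \ Q)).image ω'))
        + ∑ t ∈ T.filter (fun t => S t = S₀ᶜ),
          F t ((insert (0 : Fin 5) (({0, 2, 3, 4} : Finset (Fin 5)) \ Q)).image ω') * G t (Q.image ω'))
    (ω : Fin 5 → Fin 5) (hω : ω 0 = ω 1) (ρ : Fin 5 → Fin 5) (i₀ i₁ : Fin 5) (hi : i₀ ≠ i₁)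
    (hρ0 : ρ i₀ = 0) (hρ1 : ρ i₁ = 1)
    (L : List (Finset (Fin 5) × Finset (Fin 5)))
    (hnd : (L.map Prod.fst ++ L.map (fun e => (e.1)ᶜ)).Nodup)
    (hcov : ∀ S₀ : Finset (Fin 5), ((i₀ ∈ S₀ ∧ i₁ ∉ S₀) ∨ (i₀ ∉ S₀ ∧ i₁ ∈ S₀)) →
      S₀ ∈ L.map Prod.fst ++ L.map (fun e => (e.1)ᶜ))
    (hcan : ∀ e ∈ L,
      (e.1.image ρ).image (fun j : Fin 5 => if j = 1 then 0 else j)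
          = e.2.image (fun j : Fin 5 => if j = 1 then 0 else j) ∧
        ((e.1)ᶜ.image ρ).image (fun j : Fin 5 => if j = 1 then 0 else j)
          = (insert (0 : Fin 5) (({0, 2, 3, 4} : Finset (Fin 5)) \ e.2)).image
              (fun j : Fin 5 => if j = 1 then 0 else j)) :
    (L.map (Y ω)).sum = 0 := by
  have hcol : (ω ∘ ρ) i₀ = (ω ∘ ρ) i₁ := by
    simp only [Function.comp, hρ0, hρ1, hω]
  have h := sum_eq_sum_map_fiber T S u w ho1 ho3 (ω ∘ ρ) hi hcol _ hnd hcov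
  rw [sum_eq_zero_of_collision T u w hid (ω ∘ ρ) hi hcol, List.map_append, List.sum_append,
    List.map_map, List.map_map] at h
  -- split `Y` into its two fibers
  have hsplit : (L.map (Y ω)).sum
      = (L.map (fun e => ∑ t ∈ T.filter (fun t => S t = e.1),
          F t (e.2.image ω) * G t ((insert (0 : Fin 5) (({0, 2, 3, 4} : Finset (Fin 5)) \ e.2)).image ω))).sum
        + (L.map (fun e => ∑ t ∈ T.filter (fun t => S t = (e.1)ᶜ),
          F t ((insert (0 : Fin 5) (({0, 2, 3, 4} : Finset (Fin 5)) \ e.2)).image ω)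
            * G t (e.2.image ω))).sum := by
    rw [← List.sum_map_add]
    congr 1
    refine List.map_congr_left fun e _ => ?_
    obtain ⟨S₀, Q⟩ := e
    exact hY ω S₀ Q
  rw [hsplit, h]
  congr 1
  · congr 1
    refine List.map_congr_left fun e he => ?_
    obtain ⟨hA, hB⟩ := hcan e he
    simp only [Function.comp]
    refine Finset.sum_congr rfl fun t ht => ?_
    have hS : S t = e.1 := (Finset.mem_filter.mp ht).2
    have h1 : (S t).image (ω ∘ ρ) = e.2.image ω := by
      rw [hS, ← Finset.image_image, image_collapse ω hω, hA, ← image_collapse ω hω]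
    have h2 : ((S t)ᶜ).image (ω ∘ ρ)
        = (insert (0 : Fin 5) (({0, 2, 3, 4} : Finset (Fin 5)) \ e.2)).image ω := by
      rw [hS, ← Finset.image_image, image_collapse ω hω, hB, ← image_collapse ω hω]
    rw [hF t, hG t, h1, h2]
  · congr 1
    refine List.map_congr_left fun e he => ?_
    obtain ⟨hA, hB⟩ := hcan e he
    simp only [Function.comp]
    refine Finset.sum_congr rfl fun t ht => ?_
    have hS : S t = (e.1)ᶜ := (Finset.mem_filter.mp ht).2
    have h1 : (S t).image (ω ∘ ρ)
        = (insert (0 : Fin 5) (({0, 2, 3, 4} : Finset (Fin 5)) \ e.2)).image ω := by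
      rw [hS, ← Finset.image_image, image_collapse ω hω, hB, ← image_collapse ω hω]
    have h2 : ((S t)ᶜ).image (ω ∘ ρ) = e.2.image ω := by
      rw [hS, compl_compl, ← Finset.image_image, image_collapse ω hω, hA, ← image_collapse ω hω]
    rw [hF t, hG t, h1, h2]

/-- A nonzero flattening sum `Y ω (S₀, Q)` carries a term of `T` on `S₀` or on `S₀ᶜ`. [folklore] -/
theorem occupied_of_flat_ne_zero (F G : Fin N → Finset (Fin 5) → ℂ)
    (Y : (Fin 5 → Fin 5) → Finset (Fin 5) × Finset (Fin 5) → ℂ)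
    (hY : ∀ (ω' : Fin 5 → Fin 5) (S₀ Q : Finset (Fin 5)), Y ω' (S₀, Q)
      = (∑ t ∈ T.filter (fun t => S t = S₀),
          F t (Q.image ω') * G t ((insert (0 : Fin 5) (({0, 2, 3, 4} : Finset (Fin 5)) \ Q)).image ω'))
        + ∑ t ∈ T.filter (fun t => S t = S₀ᶜ),
          F t ((insert (0 : Fin 5) (({0, 2, 3, 4} : Finset (Fin 5)) \ Q)).image ω') * G t (Q.image ω'))
    (ω : Fin 5 → Fin 5) (S₀ Q : Finset (Fin 5)) (h : Y ω (S₀, Q) ≠ 0) :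
    ∃ t ∈ T, S t = S₀ ∨ S t = S₀ᶜ := by
  rw [hY] at h
  by_cases h1 : ∑ t ∈ T.filter (fun t => S t = S₀),
      F t (Q.image ω) * G t ((insert (0 : Fin 5) (({0, 2, 3, 4} : Finset (Fin 5)) \ Q)).image ω) = 0
  · rw [h1, zero_add] at h
    obtain ⟨t, ht, hS⟩ := occupied_of_fiber_ne_zero T S F G _ _ _ h
    exact ⟨t, ht, Or.inr hS⟩
  · obtain ⟨t, ht, hS⟩ := occupied_of_fiber_ne_zero T S F G _ _ _ h1
    exact ⟨t, ht, Or.inl hS⟩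

end LaplaceFiveOnShell

end Summit.ValiantsHypothesis.ValiantsHypothesis.Theorems.RigidityForcesSymmetryRankRigidMinimalRepr
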